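import Mathlib.Analysis.SpecialFunctions.Integrability.Basic
import Literature.NumberTheory.Transcendental.KontsevichZagierEllipticLiftProofs
import HarnessLib

/-!
# Lifting a segment between two branch points: the packaged theorem

Topic `Literature/NumberTheory/Transcendental` (family `periods`, Kontsevich–Zagier periods).
Complement to the tree's `KontsevichZagierEllipticLiftProofs.lean` (lift of a root-to-root
segment of the Weierstrass cubic through `(℘, ℘')`, by ODE uniqueness), serving the discharge of
the named facts `Literature.NumberTheory.Transcendental.isPeriod_η₂` / `isPeriod_η₁` /
`isPeriod_of_mem_lattice` of `KontsevichZagier.lean`: the periods `ω` and quasi-periods `η` of a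
lattice with invariants `g₂, g₃` are the elliptic integrals `∮ dx/y`, `-∮ x dx/y` on
`y² = f(x) = 4x³ - g₂x - g₃` (Kontsevich–Zagier 2001, §1.1; Whittaker–Watson §20.22, §20.41).

That file takes as data a branch `y` continuous on `ℝ`, a lift `u` continuous on `ℝ` and the
integrability of the integrand. This file supplies those data from the minimum and packages the
result (`exists_segmentLift`): let `a ≠ b` be roots of `f`, `x(s) = a + s(b - a)`, and note the
identity `f(x(s)) = 4(b - a)² s(s - 1) ℓ(s)`, `ℓ(s) = (b - a)s + 2a + b` (`cubic_segment_eq`, a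
`ℚ(s)`-combination of `f(a) = f(b) = 0`); assume `ℓ ≠ 0` on `[0, 1]` (no third root on the closed
segment). Then for **any** `y` differentiable on `(0, 1)` with `y² = f(x(s))` there:

* the integrands `(b - a)/y` and `x(s)(b - a)/y` are absolutely integrable on `[0, 1]`
  (`|y|² = 4|b - a|² s(1 - s)|ℓ| ≥ c·s(1 - s)`, domination by `s^{-1/2} + (1 - s)^{-1/2}`,
  `intervalIntegrable_of_norm_le_inv_sqrt`);
* the lift `w(s) = w_{1/2} + ∫_{1/2}^{s} (b - a)/y`, `(℘, ℘')(w_{1/2}) = (x(1/2), y(1/2))`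
  (`PeriodPair.exists_weierstrassP_eq` and a sign choice), satisfies `(℘, ℘') ∘ w = (x, y)` on
  `(0, 1)` (`segmentLift_Ioo`: local ODE uniqueness for `Y' = ((b - a)/y)(Y₂, 6Y₁² - g₂/2)` as in
  the tree's `eventually_weierstrassP_segmentLift`, but with `y` only differentiable on the open
  interval, plus a clopen argument), extends continuously to `[0, 1]`, and its endpoints
  `w₀, w₁` are half-period representatives (`wᵢ ∉ Λ`, `2wᵢ ∈ Λ`) over `a` and `b`
  (`weierstrassP_eq_of_tendsto`: `℘ ∘ w = x` bounded forces `w₀ ∉ Λ`; `℘'(w₀) = lim y = 0` and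
  `PeriodPair.two_mul_mem_lattice_of_derivWeierstrassP_eq_zero`);
* `w₁ - w₀ = ∫₀¹ (b - a) ds/y` and `ζ(w₁) - ζ(w₀) = -∫₀¹ x(s)(b - a) ds/y` (`ζ' = -℘` and the
  fundamental theorem of calculus with one-sided limits).

With the tree's `two_mul_weierstrassZeta_half_lattice` (`2ζ(λ/2) = mη₁ + nη₂` for
`λ = mω₁ + nω₂`) the last identity computes the quasi-period `η(2w₁ - 2w₀) = -2∫₀¹ x (b - a)/y`.

## References

* M. Kontsevich, D. Zagier, *Periods* (2001), §1.1 (elliptic integrals as periods).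
* E. T. Whittaker, G. N. Watson, *A Course of Modern Analysis*, §20.22, §20.32, §20.41.
* A. Huber, G. Wüstholz, *Transcendence and Linear Relations of 1-Periods* (2022), Ch. 18.

## Design notes

Theorems only (no definitions, no named facts). The branch `y` is hypothesis-bound and only
constrained on the open interval, so that a semialgebraic branch (principal square root after a
rotation, differentiable on `(0, 1)` but not continuous on `ℝ`) can be plugged in directly.
-/

noncomputable section

open Complex Filter Topology Set MeasureTheory intervalIntegral Bornology
open scoped PeriodPair Interval

namespace Literature.NumberTheory.Transcendental

variable (L : PeriodPair)

/-! ### Passage to the limit in `℘ ∘ w = x`, `℘' ∘ w = y` -/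

/-- If `w i → w₀` along a nontrivial filter, with `w i ∉ Λ`, `℘(w i) = x i → a` and
`℘'(w i) = y i → c`, then `w₀ ∉ Λ` (otherwise `℘(w i) → ∞`, Mathlib's double pole
`PeriodPair.order_weierstrassP` via the tree's `PeriodPair.tendsto_weierstrassP_cobounded`),
`℘(w₀) = a` and `℘'(w₀) = c`. [folklore] -/
theorem weierstrassP_eq_of_tendsto {ι : Type*} {l : Filter ι} [l.NeBot] {w x y : ι → ℂ}
    {w₀ a c : ℂ} (hw : Tendsto w l (𝓝 w₀)) (hmem : ∀ᶠ i in l, w i ∉ L.lattice)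
    (hx : ∀ᶠ i in l, ℘[L] (w i) = x i) (hy : ∀ᶠ i in l, ℘'[L] (w i) = y i)
    (hxa : Tendsto x l (𝓝 a)) (hyc : Tendsto y l (𝓝 c)) :
    w₀ ∉ L.lattice ∧ ℘[L] w₀ = a ∧ ℘'[L] w₀ = c := by
  have hw₀ : w₀ ∉ L.lattice := by
    intro h0
    have hw' : Tendsto w l (𝓝[≠] w₀) := by
      refine tendsto_nhdsWithin_iff.2 ⟨hw, hmem.mono fun i hi => ?_⟩
      rw [mem_compl_singleton_iff]
      rintro rfl
      exact hi h0
    have h1 : Tendsto (fun i => ℘[L] (w i)) l (cobounded ℂ) :=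
      (PeriodPair.tendsto_weierstrassP_cobounded h0).comp hw'
    have h2 : Tendsto (fun i => ℘[L] (w i)) l (𝓝 a) :=
      hxa.congr' (hx.mono fun i hi => hi.symm)
    exact h2.not_tendsto (Metric.disjoint_nhds_cobounded a) h1
  have hnhds : (L.lattice : Set ℂ)ᶜ ∈ 𝓝 w₀ := L.isClosed_lattice.isOpen_compl.mem_nhds hw₀
  have hPc : ContinuousAt ℘[L] w₀ :=
    (L.differentiableOn_weierstrassP.differentiableAt hnhds).continuousAt
  have hP'c : ContinuousAt ℘'[L] w₀ :=
    (L.differentiableOn_derivWeierstrassP.differentiableAt hnhds).continuousAt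
  refine ⟨hw₀, ?_, ?_⟩
  · exact tendsto_nhds_unique ((hPc.tendsto.comp hw).congr' hx) hxa
  · exact tendsto_nhds_unique ((hP'c.tendsto.comp hw).congr' hy) hyc

/-! ### The cubic along a segment -/

/-- The factorisation `f(a + s(b - a)) = 4(b - a)² s(s - 1)((b - a)s + 2a + b)` for two roots
`a, b` of `f(x) = 4x³ - g₂x - g₃` (a `ℚ(s)`-linear combination of `f(a) = 0`, `f(b) = 0`).
[folklore] -/
theorem cubic_segment_eq {g₂ g₃ a b : ℂ} (ha : 4 * a ^ 3 - g₂ * a - g₃ = 0)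
    (hb : 4 * b ^ 3 - g₂ * b - g₃ = 0) (s : ℂ) :
    4 * (a + s * (b - a)) ^ 3 - g₂ * (a + s * (b - a)) - g₃ =
      4 * (b - a) ^ 2 * s * (s - 1) * ((b - a) * s + (2 * a + b)) := by
  linear_combination s * hb + (1 - s) * ha

/-- If `y² = f(x(s))` on `(0, 1)` and `y` is differentiable at `s ∈ (0, 1)` with derivative
`y'`, then `2 y y' = (b - a) f'(x(s))` (the tree's `hasDerivAt_cubic_segment` and uniqueness of
derivatives; unlike `hasDerivAt_sqrt_cubic_segment` no continuity of `y` off `s` is used).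
[folklore] -/
theorem two_mul_mul_deriv_branch {a b : ℂ} {y : ℝ → ℂ} {s : ℝ} {y' : ℂ}
    (hy2 : ∀ s ∈ Ioo (0 : ℝ) 1,
      y s ^ 2 = 4 * (a + s * (b - a)) ^ 3 - L.g₂ * (a + s * (b - a)) - L.g₃)
    (hs : s ∈ Ioo (0 : ℝ) 1) (hyd : HasDerivAt y y' s) :
    2 * y s * y' = (b - a) * (12 * (a + s * (b - a)) ^ 2 - L.g₂) := by
  have h1 : HasDerivAt (fun s => y s ^ 2) (2 * y s * y') s := by
    refine (hyd.fun_pow 2).congr_deriv ?_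
    rw [show (2 : ℕ) - 1 = 1 from rfl]
    push_cast
    ring
  have h2 : HasDerivAt (fun s => y s ^ 2) ((b - a) * (12 * (a + s * (b - a)) ^ 2 - L.g₂)) s := by
    refine (hasDerivAt_cubic_segment L a (b - a) s).congr_of_eventuallyEq ?_
    filter_upwards [Ioo_mem_nhds hs.1 hs.2] with t ht using hy2 t ht
  exact h1.unique h2

/-! ### The lift along the open segment -/

/-- **Uniqueness of the lift along the open segment.** Let `y` be a differentiable branch of
`√f(x(s))` on `(0, 1)`, nowhere zero, and let `w` satisfy `w' = (b - a)/y` on `(0, 1)`. If at one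
point `s₀ ∈ (0, 1)` we have `w(s₀) ∉ Λ`, `℘(w(s₀)) = x(s₀)`, `℘'(w(s₀)) = y(s₀)`, then the same
holds at every point of `(0, 1)`: both `(℘ ∘ w, ℘' ∘ w)` and `(x, y)` solve
`Y' = ((b - a)/y(s)) (Y₂, 6Y₁² - g₂/2)` (`℘'' = 6℘² - g₂/2`, Whittaker–Watson §20.22), so the set
where they agree is open (local uniqueness, `ODE_solution_unique_of_eventually`) and closed in
`(0, 1)` (`weierstrassP_eq_of_tendsto`). [folklore] -/
theorem segmentLift_Ioo {a b : ℂ} {y w : ℝ → ℂ}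
    (hy2 : ∀ s ∈ Ioo (0 : ℝ) 1,
      y s ^ 2 = 4 * (a + s * (b - a)) ^ 3 - L.g₂ * (a + s * (b - a)) - L.g₃)
    (hy0 : ∀ s ∈ Ioo (0 : ℝ) 1, y s ≠ 0)
    (hyd : ∀ s ∈ Ioo (0 : ℝ) 1, DifferentiableAt ℝ y s)
    (hw : ∀ s ∈ Ioo (0 : ℝ) 1, HasDerivAt w ((b - a) / y s) s)
    {s₀ : ℝ} (hs₀ : s₀ ∈ Ioo (0 : ℝ) 1) (hw₀ : w s₀ ∉ L.lattice)
    (hP₀ : ℘[L] (w s₀) = a + s₀ * (b - a)) (hP'₀ : ℘'[L] (w s₀) = y s₀) :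
    ∀ s ∈ Ioo (0 : ℝ) 1,
      w s ∉ L.lattice ∧ ℘[L] (w s) = a + s * (b - a) ∧ ℘'[L] (w s) = y s := by
  set J : Set ℝ := {s | s ∈ Ioo (0 : ℝ) 1 ∧ w s ∉ L.lattice ∧
    ℘[L] (w s) = a + s * (b - a) ∧ ℘'[L] (w s) = y s} with hJ
  suffices h : Ioo (0 : ℝ) 1 ⊆ J from fun s hs => (h hs).2
  have hopenΛ : IsOpen ((L.lattice : Set ℂ)ᶜ) := L.isClosed_lattice.isOpen_compl
  have hxc : Continuous fun s : ℝ => a + (s : ℂ) * (b - a) := by fun_prop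
  -- Step 1: `J` is open.
  have hJopen : IsOpen J := by
    rw [isOpen_iff_mem_nhds]
    rintro s₁ ⟨hs₁, hΛ₁, hP₁, hP'₁⟩
    have hwc : ContinuousAt w s₁ := (hw s₁ hs₁).continuousAt
    have hyc : ContinuousAt y s₁ := (hyd s₁ hs₁).continuousAt
    have hIoo : ∀ᶠ s in 𝓝 s₁, s ∈ Ioo (0 : ℝ) 1 := Ioo_mem_nhds hs₁.1 hs₁.2
    have hΛev : ∀ᶠ s in 𝓝 s₁, w s ∉ L.lattice :=
      hwc.preimage_mem_nhds (hopenΛ.mem_nhds hΛ₁)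
    have hnhds₁ : (L.lattice : Set ℂ)ᶜ ∈ 𝓝 (w s₁) := hopenΛ.mem_nhds hΛ₁
    -- the two solutions and the vector field
    set Y₁ : ℝ → ℂ × ℂ := fun s => (℘[L] (w s), ℘'[L] (w s)) with hY₁
    set Y₂ : ℝ → ℂ × ℂ := fun s => (a + (s : ℂ) * (b - a), y s) with hY₂
    set v : ℝ → ℂ × ℂ → ℂ × ℂ := fun s Y => ((b - a) / y s) • L.weierstrassField Y with hv
    have heq : Y₁ s₁ = Y₂ s₁ := by simp [hY₁, hY₂, hP₁, hP'₁]
    -- Lipschitz bound near `s₁`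
    obtain ⟨K, S, hS, hK⟩ :=
      (L.contDiff_weierstrassField.contDiffAt (x := Y₁ s₁)).exists_lipschitzOnWith
    have hgc : ContinuousAt (fun s => (b - a) / y s) s₁ :=
      continuousAt_const.div hyc (hy0 s₁ hs₁)
    have hM : ∀ᶠ s in 𝓝 s₁, ‖(b - a) / y s‖ ≤ ‖(b - a) / y s₁‖ + 1 :=
      (hgc.norm.eventually (gt_mem_nhds (lt_add_one _))).mono fun s hs => hs.le
    set M : NNReal := ⟨‖(b - a) / y s₁‖ + 1, by positivity⟩ with hMdef
    have hvLip : ∀ᶠ s in 𝓝 s₁, LipschitzOnWith (M * K) (v s) S := by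
      filter_upwards [hM] with s hs
      refine LipschitzOnWith.of_dist_le_mul fun Y hY Y' hY' => ?_
      simp only [hv, dist_smul₀, NNReal.coe_mul]
      have hK' := hK.dist_le_mul Y hY Y' hY'
      have hM' : ‖(b - a) / y s‖ ≤ (M : ℝ) := hs
      calc ‖(b - a) / y s‖ * dist (L.weierstrassField Y) (L.weierstrassField Y')
          ≤ (M : ℝ) * ((K : ℝ) * dist Y Y') :=
            mul_le_mul hM' hK' dist_nonneg M.2
        _ = (M : ℝ) * (K : ℝ) * dist Y Y' := by ring
    -- `Y₁` solves the system near `s₁`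
    have hY₁S : ∀ᶠ s in 𝓝 s₁, Y₁ s ∈ S := by
      have hc : ContinuousAt Y₁ s₁ := by
        have h1 : ContinuousAt ℘[L] (w s₁) :=
          (L.differentiableOn_weierstrassP.differentiableAt hnhds₁).continuousAt
        have h2 : ContinuousAt ℘'[L] (w s₁) :=
          (L.differentiableOn_derivWeierstrassP.differentiableAt hnhds₁).continuousAt
        exact (h1.comp hwc).prodMk (h2.comp hwc)
      exact hc.preimage_mem_nhds hS
    have hY₁d : ∀ᶠ s in 𝓝 s₁, HasDerivAt Y₁ (v s (Y₁ s)) s ∧ Y₁ s ∈ S := by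
      filter_upwards [hIoo, hΛev, hY₁S] with s hs hΛ hSm
      refine ⟨?_, hSm⟩
      have h1 : HasDerivAt (fun s => ℘[L] (w s)) (((b - a) / y s) • ℘'[L] (w s)) s :=
        (L.hasDerivAt_weierstrassP hΛ).scomp s (hw s hs)
      have h2 : HasDerivAt (fun s => ℘'[L] (w s))
          (((b - a) / y s) • (6 * ℘[L] (w s) ^ 2 - L.g₂ / 2)) s :=
        (L.hasDerivAt_derivWeierstrassP hΛ).scomp s (hw s hs)
      convert h1.prodMk h2 using 1
      simp only [hv, hY₁, PeriodPair.weierstrassField, Prod.smul_mk]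
    -- `Y₂` solves the system on `(0, 1)`
    have hY₂S : ∀ᶠ s in 𝓝 s₁, Y₂ s ∈ S := by
      have hc : ContinuousAt Y₂ s₁ := hxc.continuousAt.prodMk hyc
      refine hc.preimage_mem_nhds ?_
      rwa [← heq]
    have hY₂d : ∀ᶠ s in 𝓝 s₁, HasDerivAt Y₂ (v s (Y₂ s)) s ∧ Y₂ s ∈ S := by
      filter_upwards [hIoo, hY₂S] with s hs hSm
      refine ⟨?_, hSm⟩
      have hys : y s ≠ 0 := hy0 s hs
      have hx : HasDerivAt (fun s : ℝ => a + (s : ℂ) * (b - a)) (b - a) s := by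
        simpa using ((hasDerivAt_id s).ofReal_comp.mul_const (b - a)).const_add a
      have hyd' : HasDerivAt y (deriv y s) s := (hyd s hs).hasDerivAt
      have hrel := two_mul_mul_deriv_branch L hy2 hs hyd'
      have h1 : HasDerivAt (fun s : ℝ => a + (s : ℂ) * (b - a)) (((b - a) / y s) • y s) s := by
        convert hx using 1
        rw [smul_eq_mul, div_mul_cancel₀ _ hys]
      have h2 : HasDerivAt y
          (((b - a) / y s) • (6 * (a + (s : ℂ) * (b - a)) ^ 2 - L.g₂ / 2)) s := by
        convert hyd' using 1
        have e : deriv y s = (b - a) * (12 * (a + (s : ℂ) * (b - a)) ^ 2 - L.g₂) / (2 * y s) := by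
          rw [← hrel]
          field_simp
        rw [smul_eq_mul, e]
        field_simp
        ring
      convert h1.prodMk h2 using 1
      simp only [hv, hY₂, PeriodPair.weierstrassField, Prod.smul_mk]
    have hloc : Y₁ =ᶠ[𝓝 s₁] Y₂ := ODE_solution_unique_of_eventually hvLip hY₁d hY₂d heq
    filter_upwards [hIoo, hΛev, hloc] with s hs hΛ hE
    simp only [hY₁, hY₂, Prod.mk.injEq] at hE
    exact ⟨hs, hΛ, hE.1, hE.2⟩
  -- Step 2: `J` is closed in `(0, 1)`.
  have hJclosed : closure J ∩ Ioo (0 : ℝ) 1 ⊆ J := by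
    rintro s ⟨hscl, hs⟩
    haveI hne : (𝓝[J] s).NeBot := mem_closure_iff_nhdsWithin_neBot.1 hscl
    have hwc : ContinuousAt w s := (hw s hs).continuousAt
    have hyc : ContinuousAt y s := (hyd s hs).continuousAt
    have hmem : ∀ᶠ t in 𝓝[J] s, t ∈ J := self_mem_nhdsWithin
    obtain ⟨h1, h2, h3⟩ := weierstrassP_eq_of_tendsto L (l := 𝓝[J] s)
      (hwc.tendsto.mono_left nhdsWithin_le_nhds)
      (hmem.mono fun t ht => ht.2.1) (hmem.mono fun t ht => ht.2.2.1)
      (hmem.mono fun t ht => ht.2.2.2)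
      (hxc.continuousAt.tendsto.mono_left nhdsWithin_le_nhds)
      (hyc.tendsto.mono_left nhdsWithin_le_nhds)
    exact ⟨hs, h1, h2, h3⟩
  -- Step 3: connectedness of `(0, 1)`.
  exact isPreconnected_Ioo.subset_of_closure_inter_subset hJopen
    ⟨s₀, hs₀, hs₀, hw₀, hP₀, hP'₀⟩ hJclosed

/-! ### Elementary real-analysis lemmas -/

/-- `1/√(s(1 - s)) ≤ 1/√s + 1/√(1 - s)` on `(0, 1)` (since `1/(s(1-s)) = 1/s + 1/(1-s)` and `√` is
subadditive). [folklore] -/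
theorem inv_sqrt_mul_one_sub_le {s : ℝ} (hs : s ∈ Ioo (0 : ℝ) 1) :
    (Real.sqrt (s * (1 - s)))⁻¹ ≤ (Real.sqrt s)⁻¹ + (Real.sqrt (1 - s))⁻¹ := by
  have h0 : 0 < s := hs.1
  have h1 : 0 < 1 - s := by linarith [hs.2]
  have hs0 : 0 < Real.sqrt s := Real.sqrt_pos.2 h0
  have hs1 : 0 < Real.sqrt (1 - s) := Real.sqrt_pos.2 h1
  have key : 1 ≤ Real.sqrt s + Real.sqrt (1 - s) := by
    have e0 : s ≤ Real.sqrt s := by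
      conv_lhs => rw [← Real.sqrt_sq h0.le]
      exact Real.sqrt_le_sqrt (by nlinarith [hs.2])
    have e1 : 1 - s ≤ Real.sqrt (1 - s) := by
      conv_lhs => rw [← Real.sqrt_sq h1.le]
      exact Real.sqrt_le_sqrt (by nlinarith [hs.2])
    linarith
  rw [Real.sqrt_mul h0.le, inv_le_iff_one_le_mul₀' (mul_pos hs0 hs1)]
  calc (1 : ℝ) ≤ Real.sqrt s + Real.sqrt (1 - s) := key
    _ = Real.sqrt s * Real.sqrt (1 - s) * ((Real.sqrt s)⁻¹ + (Real.sqrt (1 - s))⁻¹) := by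
        field_simp
        ring

/-- Interval integrability on `[0, 1]` of a function continuous on `(0, 1)` and dominated there
by `C((√s)⁻¹ + (√(1 - s))⁻¹)` (the power `s^{-1/2}` is integrable at `0`). [folklore] -/
theorem intervalIntegrable_of_norm_le_inv_sqrt {f : ℝ → ℂ} {C : ℝ}
    (hf : ContinuousOn f (Ioo (0 : ℝ) 1))
    (hle : ∀ s ∈ Ioo (0 : ℝ) 1, ‖f s‖ ≤ C * ((Real.sqrt s)⁻¹ + (Real.sqrt (1 - s))⁻¹)) :
    IntervalIntegrable f volume 0 1 := by
  have hG : IntervalIntegrable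
      (fun s : ℝ => C * (s ^ (-(2⁻¹ : ℝ)) + (1 - s) ^ (-(2⁻¹ : ℝ)))) volume 0 1 := by
    refine ((intervalIntegrable_rpow' ?_).add ?_).const_mul C
    · norm_num
    · have h := (intervalIntegrable_rpow' (a := 1) (b := 0) (r := -(2⁻¹ : ℝ))
        (by norm_num)).comp_sub_left 1
      simpa using h
  have hmeas : AEStronglyMeasurable f (volume.restrict (Ι (0 : ℝ) 1)) := by
    rw [uIoc_of_le zero_le_one, ← Measure.restrict_congr_set Ioo_ae_eq_Ioc]
    exact hf.aestronglyMeasurable measurableSet_Ioo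
  refine hG.mono_fun' hmeas ?_
  rw [uIoc_of_le zero_le_one, ← Measure.restrict_congr_set Ioo_ae_eq_Ioc]
  refine ae_restrict_of_forall_mem measurableSet_Ioo fun s hs => ?_
  have h0 : 0 < s := hs.1
  have h1 : 0 < 1 - s := by linarith [hs.2]
  calc ‖f s‖ ≤ C * ((Real.sqrt s)⁻¹ + (Real.sqrt (1 - s))⁻¹) := hle s hs
    _ = C * (s ^ (-(2⁻¹ : ℝ)) + (1 - s) ^ (-(2⁻¹ : ℝ))) := by
      rw [Real.sqrt_eq_rpow, Real.sqrt_eq_rpow, Real.rpow_neg h0.le, Real.rpow_neg h1.le]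
      norm_num

/-! ### The segment lift theorem -/

/-- **Lifting a segment between two branch points.** Let `a ≠ b` be roots of
`f(x) = 4x³ - g₂x - g₃` such that `ℓ(s) = (b - a)s + 2a + b` does not vanish on `[0, 1]` (no root
of `f` on the closed segment other than its endpoints, which are simple), and let `y` be a branch of
`√f(a + s(b - a))` on `(0, 1)`, i.e. `y² = f(x(s))` with `y` differentiable there. Then there are
half-period representatives `w₀, w₁` (`wᵢ ∉ Λ`, `2wᵢ ∈ Λ`) with `℘(w₀) = a`, `℘(w₁) = b`,
`w₁ - w₀ = ∫₀¹ (b - a) ds/y` and `ζ(w₁) - ζ(w₀) = -∫₀¹ x(s)(b - a) ds/y`, both integrals converging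
absolutely: the elliptic integrals of the first and second kind `∫ₐᵇ dx/y`, `-∫ₐᵇ x dx/y` along the
segment compute a half-period and the corresponding half-quasi-period
(Whittaker–Watson §20.22 `(℘')² = 4℘³ - g₂℘ - g₃`, §20.41; Kontsevich–Zagier 2001, §1.1:
elliptic integrals are periods). [cite: WhittakerWatson1927, §20.22] -/
theorem exists_segmentLift {a b : ℂ}
    (ha : 4 * a ^ 3 - L.g₂ * a - L.g₃ = 0) (hb : 4 * b ^ 3 - L.g₂ * b - L.g₃ = 0) (hab : a ≠ b)
    (hℓ : ∀ s ∈ Icc (0 : ℝ) 1, (b - a) * s + (2 * a + b) ≠ 0)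
    {y : ℝ → ℂ}
    (hy2 : ∀ s ∈ Ioo (0 : ℝ) 1,
      y s ^ 2 = 4 * (a + s * (b - a)) ^ 3 - L.g₂ * (a + s * (b - a)) - L.g₃)
    (hyd : ∀ s ∈ Ioo (0 : ℝ) 1, DifferentiableAt ℝ y s) :
    ∃ w₀ w₁ : ℂ, w₀ ∉ L.lattice ∧ w₁ ∉ L.lattice ∧ 2 * w₀ ∈ L.lattice ∧ 2 * w₁ ∈ L.lattice ∧
      ℘[L] w₀ = a ∧ ℘[L] w₁ = b ∧
      IntervalIntegrable (fun s : ℝ => (b - a) / y s) volume 0 1 ∧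
      IntervalIntegrable (fun s : ℝ => (a + s * (b - a)) * (b - a) / y s) volume 0 1 ∧
      w₁ - w₀ = ∫ s in (0 : ℝ)..1, (b - a) / y s ∧
      L.weierstrassZeta w₁ - L.weierstrassZeta w₀ =
        -∫ s in (0 : ℝ)..1, (a + s * (b - a)) * (b - a) / y s := by
  set d : ℂ := b - a with hd
  have hd0 : d ≠ 0 := sub_ne_zero.2 (Ne.symm hab)
  have hopen : IsOpen ((L.lattice : Set ℂ)ᶜ) := L.isClosed_lattice.isOpen_compl
  have hxc : Continuous fun s : ℝ => a + (s : ℂ) * d := by fun_prop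
  set ℓ : ℝ → ℂ := fun s => d * s + (2 * a + b) with hℓdef
  have hℓc : Continuous ℓ := by simp only [hℓdef]; fun_prop
  have hPfac : ∀ s : ℝ, 4 * (a + s * d) ^ 3 - L.g₂ * (a + s * d) - L.g₃ =
      4 * d ^ 2 * s * (s - 1) * ℓ s := fun s => cubic_segment_eq ha hb s
  -- `|ℓ| ≥ m > 0` on `[0, 1]`
  obtain ⟨m, hm0, hm⟩ : ∃ m : ℝ, 0 < m ∧ ∀ s ∈ Icc (0 : ℝ) 1, m ≤ ‖ℓ s‖ := by
    obtain ⟨s₀, hs₀, hmin⟩ := isCompact_Icc.exists_isMinOn (nonempty_Icc.2 (zero_le_one' ℝ))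
      hℓc.norm.continuousOn
    exact ⟨‖ℓ s₀‖, norm_pos_iff.2 (hℓ s₀ hs₀), fun s hs => hmin hs⟩
  -- `y ≠ 0` on `(0, 1)`, and the size of `y`
  have hnorm : ∀ s ∈ Ioo (0 : ℝ) 1, ‖y s‖ ^ 2 = 4 * ‖d‖ ^ 2 * (s * (1 - s)) * ‖ℓ s‖ := by
    intro s hs
    have e : 4 * d ^ 2 * (s : ℂ) * ((s : ℂ) - 1) * ℓ s = (4 : ℂ) * d ^ 2 * ((s * (s - 1) : ℝ) : ℂ) * ℓ s := by
      push_cast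
      ring
    rw [← norm_pow, hy2 s hs, hPfac s, e, norm_mul, norm_mul, norm_mul, norm_pow, Complex.norm_real,
      Real.norm_eq_abs, abs_of_nonpos (by nlinarith [hs.1, hs.2] : s * (s - 1) ≤ 0)]
    norm_num
    ring
  have hy0 : ∀ s ∈ Ioo (0 : ℝ) 1, y s ≠ 0 := by
    intro s hs h0
    have h := hnorm s hs
    rw [h0, norm_zero] at h
    have : 0 < 4 * ‖d‖ ^ 2 * (s * (1 - s)) * ‖ℓ s‖ :=
      mul_pos (mul_pos (mul_pos (by norm_num) (pow_pos (norm_pos_iff.2 hd0) 2))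
        (by nlinarith [hs.1, hs.2])) (hm0.trans_le (hm s (Ioo_subset_Icc_self hs)))
    nlinarith
  have hcont_y : ContinuousOn y (Ioo (0 : ℝ) 1) := fun s hs =>
    (hyd s hs).continuousAt.continuousWithinAt
  -- lower bound `√c √(s(1-s)) ≤ ‖y s‖`, `c = 4‖d‖²m`
  set c : ℝ := 4 * ‖d‖ ^ 2 * m with hc
  have hc0 : 0 < c := mul_pos (mul_pos (by norm_num) (pow_pos (norm_pos_iff.2 hd0) 2)) hm0
  have hlow : ∀ s ∈ Ioo (0 : ℝ) 1, Real.sqrt c * Real.sqrt (s * (1 - s)) ≤ ‖y s‖ := by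
    intro s hs
    rw [← Real.sqrt_mul hc0.le, ← Real.sqrt_sq (norm_nonneg (y s))]
    apply Real.sqrt_le_sqrt
    rw [hnorm s hs, show c * (s * (1 - s)) = 4 * ‖d‖ ^ 2 * (s * (1 - s)) * m by rw [hc]; ring]
    exact mul_le_mul_of_nonneg_left (hm s (Ioo_subset_Icc_self hs))
      (mul_nonneg (by positivity) (by nlinarith [hs.1, hs.2]))
  have hbound : ∀ s ∈ Ioo (0 : ℝ) 1, ∀ z : ℂ,
      ‖z / y s‖ ≤ ‖z‖ / Real.sqrt c * ((Real.sqrt s)⁻¹ + (Real.sqrt (1 - s))⁻¹) := by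
    intro s hs z
    have hss : 0 < s * (1 - s) := by nlinarith [hs.1, hs.2]
    have hpos : 0 < Real.sqrt c * Real.sqrt (s * (1 - s)) :=
      mul_pos (Real.sqrt_pos.2 hc0) (Real.sqrt_pos.2 hss)
    rw [norm_div]
    calc ‖z‖ / ‖y s‖ ≤ ‖z‖ / (Real.sqrt c * Real.sqrt (s * (1 - s))) :=
          div_le_div_of_nonneg_left (norm_nonneg z) hpos (hlow s hs)
      _ = ‖z‖ / Real.sqrt c * (Real.sqrt (s * (1 - s)))⁻¹ := by
          rw [div_mul_eq_div_div, div_eq_mul_inv (‖z‖ / Real.sqrt c)]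
      _ ≤ ‖z‖ / Real.sqrt c * ((Real.sqrt s)⁻¹ + (Real.sqrt (1 - s))⁻¹) :=
          mul_le_mul_of_nonneg_left (inv_sqrt_mul_one_sub_le hs) (by positivity)
  -- absolute convergence of the two elliptic integrals
  have hint1 : IntervalIntegrable (fun s : ℝ => d / y s) volume 0 1 :=
    intervalIntegrable_of_norm_le_inv_sqrt (continuousOn_const.div hcont_y hy0)
      fun s hs => hbound s hs d
  have hint2 : IntervalIntegrable (fun s : ℝ => (a + s * d) * d / y s) volume 0 1 := by
    refine intervalIntegrable_of_norm_le_inv_sqrt (C := (‖a‖ + ‖d‖) * ‖d‖ / Real.sqrt c)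
      ((hxc.mul continuous_const).continuousOn.div hcont_y hy0) fun s hs => ?_
    refine (hbound s hs _).trans ?_
    have hxle : ‖(a + (s : ℂ) * d) * d‖ ≤ (‖a‖ + ‖d‖) * ‖d‖ := by
      rw [norm_mul]
      refine mul_le_mul_of_nonneg_right ((norm_add_le _ _).trans ?_) (norm_nonneg d)
      rw [norm_mul, Complex.norm_real, Real.norm_eq_abs, abs_of_pos hs.1]
      nlinarith [norm_nonneg d, hs.2]
    gcongr
  -- the base point over `x(1/2)`
  have hhalf : (1 / 2 : ℝ) ∈ Ioo (0 : ℝ) 1 := ⟨by norm_num, by norm_num⟩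
  obtain ⟨wh, hwhΛ, hwhP, hwhP'⟩ : ∃ wh : ℂ, wh ∉ L.lattice ∧
      ℘[L] wh = a + ((1 / 2 : ℝ) : ℂ) * d ∧ ℘'[L] wh = y (1 / 2) := by
    obtain ⟨z, hz, hzP⟩ := L.exists_weierstrassP_eq (a + ((1 / 2 : ℝ) : ℂ) * d)
    have hsq : ℘'[L] z ^ 2 = y (1 / 2) ^ 2 := by
      rw [L.derivWeierstrassP_sq z hz, hzP, hy2 _ hhalf]
    rcases sq_eq_sq_iff_eq_or_eq_neg.1 hsq with h | h
    · exact ⟨z, hz, hzP, h⟩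
    · refine ⟨-z, by simpa using hz, by rw [L.weierstrassP_neg, hzP], ?_⟩
      rw [L.derivWeierstrassP_neg, h, neg_neg]
  -- the lift `w(s) = wh + ∫_{1/2}^{s} d/y`
  set g : ℝ → ℂ := fun s => d / y s with hgdef
  set w : ℝ → ℂ := fun s => wh + ∫ t in (1 / 2 : ℝ)..s, g t with hwdef
  have hg_cont : ContinuousOn g (Ioo (0 : ℝ) 1) := continuousOn_const.div hcont_y hy0
  have hsub : ∀ s ∈ Icc (0 : ℝ) 1, uIcc (1 / 2 : ℝ) s ⊆ uIcc (0 : ℝ) 1 := fun s hs => by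
    rw [uIcc_of_le (zero_le_one' ℝ)]
    exact uIcc_subset_Icc ⟨by norm_num, by norm_num⟩ hs
  have hw_deriv : ∀ s ∈ Ioo (0 : ℝ) 1, HasDerivAt w (d / y s) s := by
    intro s hs
    have h1 : IntervalIntegrable g volume (1 / 2) s := hint1.mono_set (hsub s (Ioo_subset_Icc_self hs))
    have h2 : StronglyMeasurableAtFilter g (𝓝 s) volume :=
      hg_cont.stronglyMeasurableAtFilter isOpen_Ioo s hs
    have h3 : ContinuousAt g s := hg_cont.continuousAt (Ioo_mem_nhds hs.1 hs.2)
    exact (integral_hasDerivAt_right h1 h2 h3).const_add wh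
  have hw_half : w (1 / 2) = wh := by simp [hwdef]
  -- `(℘, ℘') ∘ w = (x, y)` on the open segment
  have hJ := segmentLift_Ioo L hy2 hy0 hyd hw_deriv hhalf (by rwa [hw_half])
    (by rw [hw_half, hwhP]) (by rw [hw_half, hwhP'])
  -- continuity of `w` up to the endpoints
  have hw_cont : ContinuousOn w (Icc (0 : ℝ) 1) := by
    have hmem : (1 / 2 : ℝ) ∈ uIcc (0 : ℝ) 1 := by
      rw [uIcc_of_le (zero_le_one' ℝ)]
      exact ⟨by norm_num, by norm_num⟩
    have h := continuousOn_primitive_interval' hint1 hmem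
    rw [uIcc_of_le (zero_le_one' ℝ)] at h
    exact continuousOn_const.add h
  have hw0 : Tendsto w (𝓝[>] (0 : ℝ)) (𝓝 (w 0)) := by
    have h := ((hw_cont 0 (left_mem_Icc.2 (zero_le_one' ℝ))).tendsto).mono_left
      (nhdsWithin_mono _ Ioo_subset_Icc_self)
    rwa [nhdsWithin_Ioo_eq_nhdsGT (zero_lt_one' ℝ)] at h
  have hw1 : Tendsto w (𝓝[<] (1 : ℝ)) (𝓝 (w 1)) := by
    have h := ((hw_cont 1 (right_mem_Icc.2 (zero_le_one' ℝ))).tendsto).mono_left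
      (nhdsWithin_mono _ Ioo_subset_Icc_self)
    rwa [nhdsWithin_Ioo_eq_nhdsLT (zero_lt_one' ℝ)] at h
  have hev0 : ∀ᶠ s in 𝓝[>] (0 : ℝ), s ∈ Ioo (0 : ℝ) 1 := Ioo_mem_nhdsGT (zero_lt_one' ℝ)
  have hev1 : ∀ᶠ s in 𝓝[<] (1 : ℝ), s ∈ Ioo (0 : ℝ) 1 := Ioo_mem_nhdsLT (zero_lt_one' ℝ)
  -- `y → 0` at both endpoints
  have hFc : Continuous fun s : ℝ => Real.sqrt (4 * ‖d‖ ^ 2 * (s * (1 - s)) * ‖ℓ s‖) := by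
    have := hℓc.norm
    fun_prop
  have hy_lim0 : Tendsto y (𝓝[>] (0 : ℝ)) (𝓝 0) := by
    rw [tendsto_zero_iff_norm_tendsto_zero]
    have h0 := hFc.tendsto (0 : ℝ)
    simp only [zero_mul, mul_zero, Real.sqrt_zero] at h0
    refine (h0.mono_left nhdsWithin_le_nhds).congr' ?_
    filter_upwards [hev0] with s hs
    rw [← hnorm s hs, Real.sqrt_sq (norm_nonneg _)]
  have hy_lim1 : Tendsto y (𝓝[<] (1 : ℝ)) (𝓝 0) := by
    rw [tendsto_zero_iff_norm_tendsto_zero]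
    have h0 := hFc.tendsto (1 : ℝ)
    simp only [sub_self, zero_mul, mul_zero, Real.sqrt_zero] at h0
    refine (h0.mono_left nhdsWithin_le_nhds).congr' ?_
    filter_upwards [hev1] with s hs
    rw [← hnorm s hs, Real.sqrt_sq (norm_nonneg _)]
  -- the endpoints are half-period representatives over `a` and `b`
  obtain ⟨hw0Λ, hw0P, hw0P'⟩ := weierstrassP_eq_of_tendsto L (l := 𝓝[>] (0 : ℝ)) hw0
    (hev0.mono fun s hs => (hJ s hs).1) (hev0.mono fun s hs => (hJ s hs).2.1)
    (hev0.mono fun s hs => (hJ s hs).2.2)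
    (by simpa using (hxc.tendsto 0).mono_left nhdsWithin_le_nhds) hy_lim0
  obtain ⟨hw1Λ, hw1P, hw1P'⟩ := weierstrassP_eq_of_tendsto L (l := 𝓝[<] (1 : ℝ)) hw1
    (hev1.mono fun s hs => (hJ s hs).1) (hev1.mono fun s hs => (hJ s hs).2.1)
    (hev1.mono fun s hs => (hJ s hs).2.2)
    (by
      have h := (hxc.tendsto 1).mono_left (nhdsWithin_le_nhds (s := Iio (1 : ℝ)))
      have e : a + ((1 : ℝ) : ℂ) * d = b := by rw [hd]; push_cast; ring
      rwa [e] at h) hy_lim1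
  refine ⟨w 0, w 1, hw0Λ, hw1Λ, L.two_mul_mem_lattice_of_derivWeierstrassP_eq_zero hw0Λ hw0P',
    L.two_mul_mem_lattice_of_derivWeierstrassP_eq_zero hw1Λ hw1P', hw0P, hw1P, hint1, hint2,
    ?_, ?_⟩
  · -- `w(1) - w(0) = ∫₀¹ d/y`
    have h := integral_interval_sub_left (hint1.mono_set (hsub 1 (right_mem_Icc.2 (zero_le_one' ℝ))))
      (hint1.mono_set (hsub 0 (left_mem_Icc.2 (zero_le_one' ℝ))))
    simpa [hwdef] using h
  · -- `ζ(w(1)) - ζ(w(0)) = -∫₀¹ x d/y`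
    have hderiv : ∀ s ∈ Ioo (0 : ℝ) 1,
        HasDerivAt (fun s => L.weierstrassZeta (w s)) (-((a + s * d) * d / y s)) s := by
      intro s hs
      obtain ⟨hΛ, hP, -⟩ := hJ s hs
      have hζ' : HasDerivAt L.weierstrassZeta (-℘[L] (w s)) (w s) := by
        rw [← L.deriv_weierstrassZeta_holds (w s) hΛ]
        exact (L.differentiableOn_weierstrassZeta_holds.differentiableAt (hopen.mem_nhds hΛ)).hasDerivAt
      have h := hζ'.scomp s (hw_deriv s hs)
      refine h.congr_deriv ?_
      rw [hP, smul_eq_mul]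
      ring
    have hζc : ∀ {z : ℂ}, z ∉ L.lattice → ContinuousAt L.weierstrassZeta z := fun hz =>
      (L.differentiableOn_weierstrassZeta_holds.differentiableAt (hopen.mem_nhds hz)).continuousAt
    have hζ := integral_eq_sub_of_hasDerivAt_of_tendsto (zero_lt_one' ℝ) hderiv hint2.neg
      ((hζc hw0Λ).tendsto.comp hw0) ((hζc hw1Λ).tendsto.comp hw1)
    rw [intervalIntegral.integral_neg] at hζ
    rw [← hζ]

end Literature.NumberTheory.Transcendental
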